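import Summits.Ventures.Crystal3D.Theorems.StickyWulffConstantTextureBuildRiseredCover
import HarnessLib

/-!
# TB-1: the LABELLED POLYHEDRAL MESH v2 over a RISERED COVER — riser boxes, relaxed collar solidity and mass — and the level-2 composition of record (v3)
# (lane T, crux `TextureLiminfV5`, stmt-Ventures-23912; `stub_TB_cover` repair census TB-1-g19 §1.5/§3; cf-p1 DECISION (cliii) «A1 = GO: interface v3»)

HONEST FRAMING. Venture `Summits/Ventures/Crystal3D` (cell `crystal3d-full`), route `route-Ventures-StickyWulffConstant`, helper `--supports` the
law-v5 crux `TextureLiminfV5` (stmt-Ventures-23912).  DEFINITIONS (the part-2 interface, v2) + one composition by pure logic (census-free, standard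
axioms).  No mesh is constructed, no texture is built; rung F-C1 not moved.  As with v1 (…TextureBuildMesh, p701199) the clauses are what the texture
assembly TB-D is designed to consume; a v3 costs nothing upstream (the composition is parametric).

WHAT CHANGED vs `Mesh` v1 (…TextureBuildMesh), and why (TB-1-g19):
(1) RISER BOXES (FINDING R).  For each riser piece `r` of the cover (…TextureBuildRiseredCover: two column grains `rtL r ≠ rtR r`, owned balls, in-plane
    site sets) a bounded open H-polytope `B r`, disjoint from territories, cells, gap pieces and other boxes; `hframe`: the two tents' stackings share
    one frame and origin `(L₀, s₀)` (same layer planes; words differ on the riser layers) and `rn r = L₀ e₃`; `hBclean`: every configuration ball in the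
    closed box lies on `S_L ∪ S_R`; `hBown`: every such lattice ball is owned by SOME riser piece; `hBV`: the site sets ARE the in-plane stacking
    neighbours; `hBmatch`: every non-designated facet point of the box has a side `g ∈ {rtL r, rtR r}` whose stacking is COMPLETE near it and a
    neighbourhood inside `closure (B r) ∪` (`g`-material: territory of `g`, deep cell halves of `g`, gap pieces labelled `g`, riser boxes of the same
    pair).  Territory frontiers (`hbdry`) and gap facets (`hQmatch`) may now also be matched against riser boxes carrying their label.  TB-D draws, inside
    `B r`, the two columns separated by the vertical curtain over the honeycomb path between occupied and vacant in-plane sites and pays `≤ riserSum`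
    for it (count ⇒ charge, …TextureBuildRiserLine docstring).
(2) RELAXED COLLAR (FINDING M).  The texture of grain `f` is SOLID BY FIAT on `D f ∖ U f`; the tent solid is used only inside `U f`.  So `SolidAt` is
    asked only (a) on the part of `U f` within distance `1` of `D f ∖ U f` (`hcollar₂`: the tent solid then fills `U f` up to the collar, no facet on
    `∂U f`) and (b) at matched frontier points, only for the points of the neighbourhood that lie in `U f` (`hbdry`, `hagree`, `hwrap₁/₂`).  The deep
    interior of a territory may contain anything (foreign cosets, lock lines, junk) at zero texture cost.
(3) RELAXED MASS.  A ball counts if its `√2`-ball lies in `D f ∪` (deep halves of `f`'s cells) and EITHER it is `DeepAt f` (v1) OR its `√2`-ball misses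
    `U f` and it is LOCALLY PERFECT (`LocPerfect`: all sites of SOME Barlow stacking through it within `2√2` are balls — then its Voronoi cell is the
    lattice cell of volume `1/√2`, inside the fiat-solid texture).
THE COMPOSITION `shadowTheoremSatAtomicV5_of_risered_slack`: «TB-cover v3» (every saturated near-optimal cluster admits a RISERED cover and a mesh v2
with `tilingLoss₂ + rimSum + gapCost ≤ θ·N^{2/3} + unownedSlack₃`) + «TB-energy v3» (cover + mesh ⇒ law-v5 texture, mass `≥ (1−δ)N`,
`energy ≤ tentBudget + chargeSum + riserSum + gapCost`) + the wall law ⇒ `ShadowTheoremSatAtomicV5`, via `RiseredCover.tentBudget_add_chargeSum_le₃_slack`.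
These two inputs are the v8.7 shapes of `stub_TB_cover` / `stub_TB_energy`.
WHAT THIS IS NOT: no mesh is exhibited; the near-wall opposite-family crossing obstruction (TB-1-g19 FINDING V) is NOT addressed by this interface; F-C1 not moved.
-/

noncomputable section

open scoped BigOperators InnerProductSpace ENNReal
open MeasureTheory

namespace Summit.Ventures.Crystal3D.Cruxes.TextureLiminf.TexShadow

open Summit.Ventures.Crystal3D Summit.Ventures.Crystal3D.Theorems Finset
open Literature.MathematicalPhysics.StatisticalMechanics (IsHaggSeq fccStacking barlowStacking contactDeficiency)

namespace CellCover

variable {C R₀ : ℝ} {N : ℕ} {x : Fin N → E3}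

/-- `a` is LOCALLY PERFECT: all sites of some Barlow stacking through `a` within `2√2` of `a` are balls (its Voronoi cell is then the lattice cell). -/
def LocPerfect (cv : CellCover C R₀ N x) (a : E3) : Prop :=
  ∃ (L : E3 ≃ₗᵢ[ℝ] E3) (s : E3) (σ : ℤ → ℤ), IsHaggSeq σ ∧ a ∈ stacking L s σ ∧
    ∀ b ∈ stacking L s σ, dist a b ≤ 2 * Real.sqrt 2 → b ∈ cv.X'

/-- the stacking `S` is COMPLETE near `y` at radius `ρ`: every `S`-site within `ρ` of `y` is a ball. -/
def CompleteAt (cv : CellCover C R₀ N x) (S : Set E3) (ρ : ℝ) (y : E3) : Prop :=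
  ∀ b ∈ S, dist y b ≤ ρ → b ∈ cv.X'

end CellCover

open scoped Classical in
/-- **THE LABELLED POLYHEDRAL MESH v2 of a risered cover.** -/
structure Mesh₂ {C R₀ : ℝ} {N : ℕ} {x : Fin N → E3} (rc : RiseredCover C R₀ N x) (δ : ℝ) where
  /-- territories: finite unions of bounded open H-polytopes with unit normals -/
  nD : Fin rc.ng → ℕ
  HD : (f : Fin rc.ng) → Fin (nD f) → Finset (E3 × ℝ)
  hDbd : ∀ f j, Bornology.IsBounded (polytope (HD f j))
  hDunit : ∀ f j, ∀ p ∈ HD f j, ‖p.1‖ = 1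
  /-- designated territory facets -/
  desD : (f : Fin rc.ng) → Fin (nD f) → Finset (E3 × ℝ)
  hdesD : ∀ f j, desD f j ⊆ HD f j
  /-- the free zone is the territory minus the closed `√2`-collar of the cells -/
  hU : ∀ f, (rc.tent f).U = (⋃ j, polytope (HD f j)) \ {y | ∃ k, Metric.infDist y (rc.Z k) ≤ Real.sqrt 2}
  /-- RELAXED collar solidity: only the part of the free zone within `1` of the collar must be solid (the rest of the territory is solid by fiat) -/
  hcollar₂ : ∀ f, ∀ z ∈ (rc.tent f).U, Metric.infDist z ((⋃ j, polytope (HD f j)) \ (rc.tent f).U) < 1 → rc.SolidAt f z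
  /-- cells ↔ grains -/
  fk : Fin rc.nk → Fin rc.ng
  gk : Fin rc.nk → Fin rc.ng
  hfg : ∀ k, fk k ≠ gk k
  /-- gap pieces with grain labels -/
  nQ : ℕ
  HQ : Fin nQ → Finset (E3 × ℝ)
  lab : Fin nQ → Fin rc.ng
  /-- RISER BOXES, one per riser piece of the cover -/
  HB : Fin rc.nr → Finset (E3 × ℝ)
  hBbd : ∀ r, Bornology.IsBounded (polytope (HB r))
  hBunit : ∀ r, ∀ p ∈ HB r, ‖p.1‖ = 1
  desB : Fin rc.nr → Finset (E3 × ℝ)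
  hdesB : ∀ r, desB r ⊆ HB r
  /-- the territory boundary: EMPTY, or DESIGNATED, or matched with `f`-material across (deep cell halves, gap pieces, riser boxes carrying `f`,
  another territory in solid agreement); tent solidity is asked only on the free-zone part of the neighbourhood -/
  hbdry : ∀ f, ∀ y ∈ frontier (⋃ j, polytope (HD f j)),
    rc.EmptyAt f y ∨ (∃ j, ∃ p ∈ desD f j, y ∈ facetOf (HD f j) p) ∨
      ∃ r : ℝ, 0 < r ∧ (∀ z ∈ Metric.ball y r, z ∈ (rc.tent f).U → rc.SolidAt f z) ∧
        Metric.ball y r ⊆ closure (⋃ j, polytope (HD f j)) ∪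
          ((⋃ k ∈ (Finset.univ.filter fun k => fk k = f), rc.Zlow k) ∪
            (⋃ k ∈ (Finset.univ.filter fun k => gk k = f), rc.Zhigh k) ∪
            (⋃ l ∈ (Finset.univ.filter fun l => lab l = f), closure (polytope (HQ l))) ∪
            (⋃ r' ∈ (Finset.univ.filter fun r' => rc.rtL r' = f ∨ rc.rtR r' = f), closure (polytope (HB r'))) ∪
            (⋃ g ∈ (Finset.univ.filter fun g => g ≠ f), {z | z ∈ closure (⋃ j, polytope (HD g j)) ∧
              (z ∈ (rc.tent g).U → rc.SolidAt g z) ∧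
              ∃ r' : ℝ, 0 < r' ∧ rc.S f ∩ Metric.ball z (r' + 4) = rc.S g ∩ Metric.ball z (r' + 4)}))
  /-- stacking consistency of the cells with the grains' tents -/
  hS₁ : ∀ k, rigid (rc.cell k).M (rc.cell k).t '' stacking (rc.cell k).L₁ (rc.cell k).s₁ (rc.cell k).σ₁ = rc.S (fk k)
  hS₂ : ∀ k, rigid (rc.cell k).M (rc.cell k).t '' stacking (rc.cell k).L₂ (rc.cell k).s₂ (rc.cell k).σ₂ = rc.S (gk k)
  /-- disjointness of territories, and of territories from the closed cells -/
  hDD : ∀ f g, f ≠ g → Disjoint (⋃ j, polytope (HD f j)) (⋃ j, polytope (HD g j))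
  hDZ : ∀ f k, Disjoint (⋃ j, polytope (HD f j)) (rc.Z k)
  /-- which territories touch a cell, and where -/
  hside₁ : ∀ k, ∀ y ∈ closure (⋃ j, polytope (HD (fk k) j)) ∩ rc.Z k, rc.height k y ≤ -R₀
  hside₂ : ∀ k, ∀ y ∈ closure (⋃ j, polytope (HD (gk k) j)) ∩ rc.Z k, (rc.cell k).h + R₀ ≤ rc.height k y
  hside₀ : ∀ k f, f ≠ fk k → f ≠ gk k → Disjoint (closure (⋃ j, polytope (HD f j))) (rc.Z k)
  /-- agreement contacts between territories: free-zone parts solid, stackings coincide nearby -/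
  hagree : ∀ f g, f ≠ g → ∀ y ∈ closure (⋃ j, polytope (HD f j)) ∩ closure (⋃ j, polytope (HD g j)),
    ∃ r : ℝ, 0 < r ∧ (∀ z ∈ Metric.ball y r, (z ∈ (rc.tent f).U → rc.SolidAt f z) ∧ (z ∈ (rc.tent g).U → rc.SolidAt g z)) ∧
      rc.S f ∩ Metric.ball y (r + 4) = rc.S g ∩ Metric.ball y (r + 4)
  /-- the deep parts of a cell are WRAPPED in territory of the right grain (solid where it is free zone) -/
  hwrap₁ : ∀ k, ∀ y ∈ rc.Z k, rc.height k y ≤ -R₀ → ∃ r : ℝ, 0 < r ∧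
    Metric.ball y r ⊆ rc.Z k ∪ {z | z ∈ closure (⋃ j, polytope (HD (fk k) j)) ∧ (z ∈ (rc.tent (fk k)).U → rc.SolidAt (fk k) z)}
  hwrap₂ : ∀ k, ∀ y ∈ rc.Z k, (rc.cell k).h + R₀ ≤ rc.height k y → ∃ r : ℝ, 0 < r ∧
    Metric.ball y r ⊆ rc.Z k ∪ {z | z ∈ closure (⋃ j, polytope (HD (gk k) j)) ∧ (z ∈ (rc.tent (gk k)).U → rc.SolidAt (gk k) z)}
  /-- the cells' law tables are FULL -/
  hlaw : ∀ k i j, (¬ CoAx ((rc.cell k).A₁ i) ((rc.cell k).A₂ j) → (13 / 25 : ℝ) ≤ (rc.cell k).c i j) ∧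
    (CoAx ((rc.cell k).A₁ i) ((rc.cell k).A₂ j) → (rc.cell k).A₁ i '' fccRef ≠ (rc.cell k).A₂ j '' fccRef →
      1 / 2 * Real.sqrt (1 - ⟪(rc.cell k).m i j, e₃⟫_ℝ ^ 2) ≤ (rc.cell k).c i j)
  /-- gap pieces: bounded open polytopes, disjoint from everything -/
  hQbd : ∀ l, Bornology.IsBounded (polytope (HQ l))
  hQunit : ∀ l, ∀ p ∈ HQ l, ‖p.1‖ = 1
  hQD : ∀ l f, Disjoint (polytope (HQ l)) (⋃ j, polytope (HD f j))
  hQZ : ∀ l k, Disjoint (polytope (HQ l)) (rc.Z k)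
  hQQ : ∀ l l', l ≠ l' → Disjoint (polytope (HQ l)) (polytope (HQ l'))
  /-- riser boxes: disjoint from territories, cells, gap pieces and each other -/
  hBD : ∀ r f, Disjoint (polytope (HB r)) (⋃ j, polytope (HD f j))
  hBZ : ∀ r k, Disjoint (polytope (HB r)) (rc.Z k)
  hBQ : ∀ r l, Disjoint (polytope (HB r)) (polytope (HQ l))
  hBB : ∀ r r', r ≠ r' → Disjoint (polytope (HB r)) (polytope (HB r'))
  /-- riser boxes: the two column grains share one frame and origin (same layer planes), the piece's normal is that layer normal -/
  hframe : ∀ r, ∃ (L₀ : E3 ≃ₗᵢ[ℝ] E3) (s₀ : E3) (σL σR : ℤ → ℤ), IsHaggSeq σL ∧ IsHaggSeq σR ∧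
    rc.S (rc.rtL r) = stacking L₀ s₀ σL ∧ rc.S (rc.rtR r) = stacking L₀ s₀ σR ∧ rc.rn r = L₀ e₃
  /-- riser boxes: every configuration ball in the closed box lies on one of the two stackings, and every such ball is owned by some riser piece -/
  hBclean : ∀ r, ∀ q ∈ rc.X', q ∈ closure (polytope (HB r)) → q ∈ rc.S (rc.rtL r) ∪ rc.S (rc.rtR r)
  hBown : ∀ r, ∀ q ∈ rc.X', q ∈ closure (polytope (HB r)) → ∃ r', q ∈ rc.rown r'
  /-- riser pieces: the site sets ARE the in-plane stacking neighbours -/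
  hBV : ∀ r, ∀ b ∈ rc.rown r, (b ∈ rc.S (rc.rtL r) → (↑(rc.rV r b) : Set E3) = {v | v ∈ rc.S (rc.rtL r) ∧ dist b v = 1 ∧ ⟪v - b, rc.rn r⟫_ℝ = 0}) ∧
    (b ∈ rc.S (rc.rtR r) → (↑(rc.rV r b) : Set E3) = {v | v ∈ rc.S (rc.rtR r) ∧ dist b v = 1 ∧ ⟪v - b, rc.rn r⟫_ℝ = 0})
  /-- matching of the non-designated riser-box facets: a side whose stacking is complete nearby, and that side's material across -/
  hBmatch : ∀ r, ∀ p ∈ HB r \ desB r, ∀ y ∈ facetOf (HB r) p, ∃ ρ' : ℝ, 0 < ρ' ∧ ∃ g : Fin rc.ng, (g = rc.rtL r ∨ g = rc.rtR r) ∧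
    rc.CompleteAt (rc.S g) (ρ' + 4) y ∧
    Metric.ball y ρ' ⊆ closure (polytope (HB r)) ∪
      ((closure (⋃ j, polytope (HD g j))) ∪
        (⋃ k ∈ (Finset.univ.filter fun k => fk k = g), rc.Zlow k) ∪
        (⋃ k ∈ (Finset.univ.filter fun k => gk k = g), rc.Zhigh k) ∪
        (⋃ l ∈ (Finset.univ.filter fun l => lab l = g), closure (polytope (HQ l))) ∪
        (⋃ r' ∈ (Finset.univ.filter fun r' => r' ≠ r ∧ (rc.rtL r' = rc.rtL r ∧ rc.rtR r' = rc.rtR r ∨ rc.rtL r' = rc.rtR r ∧ rc.rtR r' = rc.rtL r)),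
          closure (polytope (HB r'))))
  /-- designated gap facets -/
  desQ : Fin nQ → Finset (E3 × ℝ)
  hdesQ : ∀ l, desQ l ⊆ HQ l
  /-- matching of the non-designated gap facets: the far side is material of the label (now including riser boxes carrying the label) -/
  hQmatch : ∀ l, ∀ p ∈ HQ l \ desQ l, ∀ y ∈ facetOf (HQ l) p, ∃ r : ℝ, 0 < r ∧
    Metric.ball y r ⊆ closure (polytope (HQ l)) ∪
      ((closure (⋃ j, polytope (HD (lab l) j))) ∪
        (⋃ k ∈ (Finset.univ.filter fun k => fk k = lab l), rc.Zlow k) ∪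
        (⋃ k ∈ (Finset.univ.filter fun k => gk k = lab l), rc.Zhigh k) ∪
        (⋃ l' ∈ (Finset.univ.filter fun l' => lab l' = lab l), closure (polytope (HQ l'))) ∪
        (⋃ r' ∈ (Finset.univ.filter fun r' => rc.rtL r' = lab l ∨ rc.rtR r' = lab l), closure (polytope (HB r'))) ∪
        (⋃ g ∈ (Finset.univ.filter fun g => g ≠ lab l), {z | z ∈ closure (⋃ j, polytope (HD g j)) ∧ (z ∈ (rc.tent g).U → rc.SolidAt g z) ∧
          ∃ r' : ℝ, 0 < r' ∧ rc.S (lab l) ∩ Metric.ball z (r' + 4) = rc.S g ∩ Metric.ball z (r' + 4)}))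
  /-- the gap budget: designated facets of gap pieces, territories and riser boxes -/
  gapArea : ℝ
  hgapArea : (∑ l, ∑ p ∈ desQ l, facetArea (facetOf (HQ l) p) p.1) +
      (∑ f, ∑ j, ∑ p ∈ desD f j, facetArea (facetOf (HD f j) p) p.1) +
      (∑ r, ∑ p ∈ desB r, facetArea (facetOf (HB r) p) p.1) ≤ gapArea
  /-- RELAXED mass: at least `(1 − δ)N` balls are deep in a territory (tent-deep, or away from the free zone and locally perfect) or a cell half -/
  hmass : (1 - δ) * (N : ℝ) ≤
    ((Finset.univ.filter fun i : Fin rc.N' => ∃ f,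
      (rc.DeepAt f (rc.x' i) ∨ (Disjoint (Metric.closedBall (rc.x' i) (Real.sqrt 2)) (rc.tent f).U ∧ rc.LocPerfect (rc.x' i))) ∧
      Metric.closedBall (rc.x' i) (Real.sqrt 2) ⊆ (⋃ j, polytope (HD f j)) ∪
        (⋃ k ∈ (Finset.univ.filter fun k => fk k = f), rc.Zlow k) ∪
        (⋃ k ∈ (Finset.univ.filter fun k => gk k = f), rc.Zhigh k)).card : ℝ)

namespace Mesh₂

variable {C R₀ : ℝ} {N : ℕ} {x : Fin N → E3} {rc : RiseredCover C R₀ N x} {δ : ℝ}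

/-- the territory of grain `f` -/
def D (μ : Mesh₂ rc δ) (f : Fin rc.ng) : Set E3 := ⋃ j, polytope (μ.HD f j)

/-- the gap piece `l` -/
def Q (μ : Mesh₂ rc δ) (l : Fin μ.nQ) : Set E3 := polytope (μ.HQ l)

/-- the riser box `r` -/
def B (μ : Mesh₂ rc δ) (r : Fin rc.nr) : Set E3 := polytope (μ.HB r)

/-- the GAP COST: designated facets plus the cells' lateral surfaces, times the support bound `3`. -/
def gapCost (μ : Mesh₂ rc δ) : ℝ := 3 * (μ.gapArea + ∑ k, 2 * Real.pi * (rc.cell k).ρ * ((rc.cell k).h + 4 * R₀ + 2))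

end Mesh₂

/-! ## The level-2 composition of record (interface v3, slack form) -/

/-- **THE LEVEL-2 COMPOSITION over risered cover + mesh v2, WITH SLACK** (adhesion hypothesis arbitrary): «TB-cover v3» + «TB-energy v3» + the wall law
⇒ the atomic-scale saturated shadow theorem.  `energy ≤ tent + charge + riser + gap ≤ Def − slack + tilingLoss₂ + rimSum + gap ≤ Def + θN^{2/3}`. -/
theorem shadowTheoremSatAtomicV5_of_risered_slack {Adh : Prop}
    (hcover : BarlowResolution → Adh →
      ∀ C R₀ : ℝ, 1 ≤ R₀ → ∀ K δ θ : ℝ, 0 < δ → 0 < θ → ∃ N₀ : ℕ, ∀ N : ℕ, N₀ ≤ N → ∀ x : Fin N → E3, IsUnitPacking x →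
        IsSaturated x → 6 * (N : ℝ) - (numContacts x : ℝ) ≤ K * (N : ℝ) ^ ((2 : ℝ) / 3) →
        ∃ (rc : RiseredCover C R₀ N x) (μ : Mesh₂ rc δ),
          rc.tilingLoss₂ + rc.rimSum + μ.gapCost ≤ θ * (N : ℝ) ^ ((2 : ℝ) / 3) + rc.unownedSlack₃)
    (henergy : PolytopeCalculus → BarlowFreeCertificate →
      ∀ (C R₀ : ℝ) (N : ℕ) (x : Fin N → E3) (δ : ℝ) (rc : RiseredCover C R₀ N x) (μ : Mesh₂ rc δ),
        ∃ (n : ℕ) (G : Fin n → Set E3) (A : Fin n → (E3 ≃ₗᵢ[ℝ] E3)) (c : Fin n → Fin n → ℝ) (m : Fin n → Fin n → E3),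
          IsTexture (13 / 25) (1 / 2) n G A c m ∧ (1 - δ) * (N : ℝ) ≤ Real.sqrt 2 * vol n G ∧
          energy n G A c m ≤ rc.tentBudget + rc.chargeSum + rc.riserSum + μ.gapCost) :
    BarlowResolution → Adh → BilayerWallV5 → PolytopeCalculus → BarlowFreeCertificate → ShadowTheoremSatAtomicV5 := by
  intro hres hadh hBW hpoly hfree _hG _hC _hNRG _hSL K δ θ hδ hθ
  obtain ⟨C, R₀, hR₀, hW⟩ := hBW
  obtain ⟨N₀, hN₀⟩ := hcover hres hadh C R₀ hR₀ K δ θ hδ hθ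
  refine ⟨N₀, fun N hN x hx hsat hK => ?_⟩
  obtain ⟨rc, μ, hslack⟩ := hN₀ N hN x hx hsat hK
  obtain ⟨n, G, A, c, m, hT, hvol, hEn⟩ := henergy hpoly hfree C R₀ N x δ rc μ
  refine ⟨n, G, A, c, m, hT, hvol, ?_⟩
  have hdisc := rc.tentBudget_add_chargeSum_le₃_slack hR₀ hW
  linarith

/-- **THE v8.7 COMPOSITION OF RECORD**: TB-cover v3 (T-form adhesion, slack target) + TB-energy v3 ⇒ the registered shape of `stub_textureBuild`. -/
theorem textureBuildR_of_stubs
    (hcover : BarlowResolution → BarlowAdhesionT →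
      ∀ C R₀ : ℝ, 1 ≤ R₀ → ∀ K δ θ : ℝ, 0 < δ → 0 < θ → ∃ N₀ : ℕ, ∀ N : ℕ, N₀ ≤ N → ∀ x : Fin N → E3, IsUnitPacking x →
        IsSaturated x → 6 * (N : ℝ) - (numContacts x : ℝ) ≤ K * (N : ℝ) ^ ((2 : ℝ) / 3) →
        ∃ (rc : RiseredCover C R₀ N x) (μ : Mesh₂ rc δ),
          rc.tilingLoss₂ + rc.rimSum + μ.gapCost ≤ θ * (N : ℝ) ^ ((2 : ℝ) / 3) + rc.unownedSlack₃)
    (henergy : PolytopeCalculus → BarlowFreeCertificate →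
      ∀ (C R₀ : ℝ) (N : ℕ) (x : Fin N → E3) (δ : ℝ) (rc : RiseredCover C R₀ N x) (μ : Mesh₂ rc δ),
        ∃ (n : ℕ) (G : Fin n → Set E3) (A : Fin n → (E3 ≃ₗᵢ[ℝ] E3)) (c : Fin n → Fin n → ℝ) (m : Fin n → Fin n → E3),
          IsTexture (13 / 25) (1 / 2) n G A c m ∧ (1 - δ) * (N : ℝ) ≤ Real.sqrt 2 * vol n G ∧
          energy n G A c m ≤ rc.tentBudget + rc.chargeSum + rc.riserSum + μ.gapCost) :
    BarlowResolution → BarlowAdhesionT → BilayerWallV5 → PolytopeCalculus → BarlowFreeCertificate → ShadowTheoremSatV5 :=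
  textureBuild_of_atomic (shadowTheoremSatAtomicV5_of_risered_slack hcover henergy)

end Summit.Ventures.Crystal3D.Cruxes.TextureLiminf.TexShadow

end
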